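import Summits.CriticalPhenomena.Ising3DConformalLimit.Theses.PrecisionLaplacian
import HarnessLib

/-!
# Monotone Tauberian step on `ℕ` — stub `stub_monotoneTauberian` of line `self-energy-pick-inversion`
# (crux `PrecisionLaplacian.DirectCorrelationStableTail`, stmt-CriticalPhenomena-4799)

Ising-free real analysis, pure theorem file (no definitions).  A sequence `S : ℕ → ℝ` that is `≥ 0` and
non-increasing from `n = 1` on, and whose rescaled counting functionals `R^α Σ'_n S(n) g(n/R)` converge to
`F ∫₀^∞ g(s) s^{-(1+α)} ds` for every continuous `g` compactly supported in `(0,∞)`, satisfies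
`S(n)·n^{1+α} → F`.

Proof (sandwich / monotone density argument).  Test the hypothesis with continuous trapezoids (Urysohn)
`𝟙_{[1-δ,1]} ≤ g⁺ ≤ 𝟙_{(1-δ-δ²,1+δ²)}` and `𝟙_{[1+δ²,1+δ-δ²]} ≤ g⁻ ≤ 𝟙_{(1,1+δ)}`.  Monotonicity of `S` gives
`δ · S(R) R^{1+α} ≤ R^α Σ S(n) g⁺(n/R)` and `R^α Σ S(n) g⁻(n/R) ≤ S(R) R^{1+α} (δ + 1/R)`; the limit integrals
are bounded by the elementary estimates `b'^{-(1+α)} ≤ s^{-(1+α)} ≤ a'^{-(1+α)}` on the supports; finally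
`δ → 0⁺`.  [folklore; Bingham–Goldie–Teugels 1987, §1.7 (monotone density theorem) for the continuous analogue]
-/

open Filter MeasureTheory

namespace Summit.CriticalPhenomena.Ising3DConformalLimit.Cruxes.DirectCorrelationStableTail.SelfEnergyPickInversion

/-- Continuous trapezoid (Urysohn): `g = 1` on `[a,b]`, `g = 0` off `(a',b')`, `0 ≤ g ≤ 1`, compactly
supported inside `(0,∞)`, for `0 < a' < a ≤ b < b'`. -/
theorem monoTaub_trapezoid {a' a b b' : ℝ} (ha' : 0 < a') (haa : a' < a) (hab : a ≤ b)
    (hbb : b < b') :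
    ∃ g : ℝ → ℝ, Continuous g ∧ HasCompactSupport g ∧ tsupport g ⊆ Set.Ioi 0 ∧ (∀ x, 0 ≤ g x) ∧
      (∀ x, g x ≤ 1) ∧ (∀ x ∈ Set.Icc a b, g x = 1) ∧ (∀ x, x ∉ Set.Ioo a' b' → g x = 0) := by
  have hlt : a' < b' := (haa.trans_le hab).trans hbb
  have hsub : Set.Icc a b ⊆ Set.Ioo a' b' := fun x hx => ⟨haa.trans_le hx.1, hx.2.trans_lt hbb⟩
  have hcl : IsCompact (closure (Set.Ioo a' b')) := by
    rw [closure_Ioo hlt.ne]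
    exact isCompact_Icc
  obtain ⟨f, hfs, hf1, hf01⟩ :=
    exists_tsupport_one_of_isOpen_isClosed isOpen_Ioo hcl isClosed_Icc hsub
  refine ⟨f, f.continuous, ?_, hfs.trans fun x hx => ha'.trans hx.1, fun x => (hf01 x).1,
    fun x => (hf01 x).2, fun x hx => hf1 hx, fun x hx => ?_⟩
  · exact IsCompact.of_isClosed_subset isCompact_Icc (isClosed_tsupport _)
      (hfs.trans Set.Ioo_subset_Icc_self)
  · exact image_eq_zero_of_notMem_tsupport fun h => hx (hfs h)

/-- Elementary two-sided bounds for `∫₀^∞ g(s) s^{-(1+α)} ds` when `𝟙_{[a,b]} ≤ g ≤ 𝟙_{(a',b')}` with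
`0 < a' ≤ a ≤ b ≤ b'`: the integrand lies between `b'^{-(1+α)}` and `a'^{-(1+α)}` on the relevant sets. -/
theorem monoTaub_integral_bounds {α a' a b b' : ℝ} (hα : 0 < α) (ha' : 0 < a') (haa : a' ≤ a)
    (hab : a ≤ b) (hbb : b ≤ b') {g : ℝ → ℝ} (hg : Continuous g) (hg0 : ∀ x, 0 ≤ g x)
    (hg1 : ∀ x, g x ≤ 1) (hgab : ∀ x ∈ Set.Icc a b, g x = 1)
    (hgz : ∀ x, x ∉ Set.Ioo a' b' → g x = 0) :
    (b - a) * b' ^ (-(1 + α)) ≤ ∫ s in Set.Ioi (0 : ℝ), g s * s ^ (-(1 + α)) ∧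
      ∫ s in Set.Ioi (0 : ℝ), g s * s ^ (-(1 + α)) ≤ (b' - a') * a' ^ (-(1 + α)) := by
  have hp : -(1 + α) ≤ 0 := by linarith
  have hcont : ContinuousOn (fun s : ℝ => g s * s ^ (-(1 + α))) (Set.Icc a' b') :=
    hg.continuousOn.mul (continuousOn_id.rpow_const fun x hx => Or.inl (ha'.trans_le hx.1).ne')
  have hint : IntegrableOn (fun s : ℝ => g s * s ^ (-(1 + α))) (Set.Icc a' b') :=
    hcont.integrableOn_Icc
  have hzero : ∀ x, x ∉ Set.Icc a' b' → g x * x ^ (-(1 + α)) = 0 := fun x hx => by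
    rw [hgz x fun h => hx (Set.Ioo_subset_Icc_self h), zero_mul]
  have heq : ∫ s in Set.Ioi (0 : ℝ), g s * s ^ (-(1 + α)) =
      ∫ s in Set.Icc a' b', g s * s ^ (-(1 + α)) :=
    setIntegral_eq_of_subset_of_forall_sdiff_eq_zero measurableSet_Ioi
      (fun x hx => ha'.trans_le hx.1) fun x hx => hzero x hx.2
  have hnn : ∀ x, 0 ≤ g x * x ^ (-(1 + α)) := fun x => by
    by_cases hx : x ∈ Set.Ioo a' b'
    · exact mul_nonneg (hg0 x) (Real.rpow_nonneg (ha'.trans hx.1).le _)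
    · rw [hgz x hx, zero_mul]
  have hvol : ∀ u v : ℝ, volume (Set.Icc u v) ≠ ⊤ := fun u v => by
    rw [Real.volume_Icc]
    exact ENNReal.ofReal_ne_top
  rw [heq]
  refine ⟨?_, ?_⟩
  · have h1 : (b - a) * b' ^ (-(1 + α)) ≤ ∫ s in Set.Icc a b, g s * s ^ (-(1 + α)) := by
      have key := setIntegral_ge_of_const_le_real (μ := volume)
        (f := fun s : ℝ => g s * s ^ (-(1 + α))) (c := b' ^ (-(1 + α))) measurableSet_Icc
        (hvol a b) (fun x hx => ?_) (hint.mono_set (Set.Icc_subset_Icc haa hbb))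
      · rwa [Real.volume_real_Icc_of_le hab, mul_comm] at key
      · rw [hgab x hx, one_mul]
        exact Real.rpow_le_rpow_of_nonpos ((ha'.trans_le haa).trans_le hx.1) (hx.2.trans hbb) hp
    exact h1.trans (setIntegral_mono_set hint (Eventually.of_forall hnn)
      (Set.Icc_subset_Icc haa hbb).eventuallyLE)
  · have key := norm_setIntegral_le_of_norm_le_const (μ := volume)
      (f := fun s : ℝ => g s * s ^ (-(1 + α))) (s := Set.Icc a' b') (C := a' ^ (-(1 + α)))
      ((hvol a' b').lt_top) fun x hx => ?_
    · rw [Real.volume_real_Icc_of_le (haa.trans (hab.trans hbb)), mul_comm, Real.norm_eq_abs] at key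
      exact (le_abs_self _).trans key
    · rw [Real.norm_eq_abs, abs_of_nonneg (hnn x), ← one_mul (a' ^ (-(1 + α)))]
      exact mul_le_mul (hg1 x) (Real.rpow_le_rpow_of_nonpos ha' hx.1 hp)
        (Real.rpow_nonneg (ha'.trans_le hx.1).le _) zero_le_one

/-- A sequence non-increasing from `n = 1` on satisfies `S n ≤ S m` for `1 ≤ m ≤ n`. -/
theorem monoTaub_antitone {S : ℕ → ℝ} (hstep : ∀ n : ℕ, 1 ≤ n → S (n + 1) ≤ S n) {m n : ℕ}
    (hm : 1 ≤ m) (hmn : m ≤ n) : S n ≤ S m := by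
  induction n, hmn using Nat.le_induction with
  | base => exact le_rfl
  | succ k hk ih => exact (hstep k (hm.trans hk)).trans ih

/-- For `g` vanishing off `(a', b')` with `0 < a'` and `b' ≤ 2`, the series `Σ'_n S(n) g(n/R)` is the finite
sum over `n < 2R` (all other terms vanish; for `R = 0` every term vanishes). -/
theorem monoTaub_tsum_eq_sum (S : ℕ → ℝ) {g : ℝ → ℝ} {a' b' : ℝ} (ha' : 0 < a') (hb' : b' ≤ 2)
    (hgz : ∀ x, x ∉ Set.Ioo a' b' → g x = 0) (R : ℕ) :
    ∑' n : ℕ, S n * g ((n : ℝ) / (R : ℝ)) =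
      ∑ n ∈ Finset.range (2 * R), S n * g ((n : ℝ) / (R : ℝ)) := by
  refine tsum_eq_sum fun n hn => ?_
  rw [Finset.mem_range, not_lt] at hn
  rw [hgz _ ?_, mul_zero]
  rintro ⟨h1, h2⟩
  rcases Nat.eq_zero_or_pos R with hR | hR
  · subst hR
    simp only [Nat.cast_zero, div_zero] at h1
    linarith
  · have hRpos : (0 : ℝ) < R := Nat.cast_pos.mpr hR
    have h3 : (2 : ℝ) ≤ n / R := by
      rw [le_div_iff₀ hRpos]
      exact_mod_cast hn
    linarith

/-- Each term `S(n) g(n/R)` of the functional of a test function `g ≥ 0` with `g 0 = 0` is `≥ 0`. -/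
theorem monoTaub_term_nonneg {S : ℕ → ℝ} (hS0 : ∀ n : ℕ, 1 ≤ n → 0 ≤ S n) {g : ℝ → ℝ}
    (hg0 : ∀ x, 0 ≤ g x) (hgz : g 0 = 0) (R n : ℕ) : 0 ≤ S n * g ((n : ℝ) / (R : ℝ)) := by
  rcases Nat.eq_zero_or_pos n with rfl | hn
  · simp [hgz]
  · exact mul_nonneg (hS0 n hn) (hg0 _)

/-- Lower sandwich: for `g ≥ 0` with `g 0 = 0`, `g = 1` on `[1-δ, 1]`, and `R ≥ 1`,
`δ · S(R) R^{1+α} ≤ R^α Σ_{n<2R} S(n) g(n/R)` (monotonicity on `(1-δ)R ≤ n ≤ R`). -/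
theorem monoTaub_sum_lower {S : ℕ → ℝ} (hS0 : ∀ n : ℕ, 1 ≤ n → 0 ≤ S n)
    (hstep : ∀ n : ℕ, 1 ≤ n → S (n + 1) ≤ S n) {g : ℝ → ℝ} (hg0 : ∀ x, 0 ≤ g x) (hgz : g 0 = 0)
    {δ : ℝ} (hδ : 0 < δ) (hδ1 : δ ≤ 1 / 2) (hg1 : ∀ x ∈ Set.Icc (1 - δ) 1, g x = 1) (α : ℝ)
    {R : ℕ} (hR : 1 ≤ R) :
    δ * (S R * (R : ℝ) ^ (1 + α)) ≤
      (R : ℝ) ^ α * ∑ n ∈ Finset.range (2 * R), S n * g ((n : ℝ) / (R : ℝ)) := by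
  have hRpos : (0 : ℝ) < R := Nat.cast_pos.mpr hR
  have hx0 : 0 ≤ (1 - δ) * (R : ℝ) := mul_nonneg (by linarith) hRpos.le
  set c : ℕ := ⌈(1 - δ) * (R : ℝ)⌉₊ with hc
  have hcR : c ≤ R := Nat.ceil_le.mpr (mul_le_of_le_one_left hRpos.le (by linarith))
  have hsub : Finset.Icc c R ⊆ Finset.range (2 * R) := fun n hn => by
    rw [Finset.mem_Icc] at hn
    rw [Finset.mem_range]
    omega
  have h1 : ∑ n ∈ Finset.Icc c R, S n * g ((n : ℝ) / (R : ℝ)) ≤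
      ∑ n ∈ Finset.range (2 * R), S n * g ((n : ℝ) / (R : ℝ)) :=
    Finset.sum_le_sum_of_subset_of_nonneg hsub fun n _ _ => monoTaub_term_nonneg hS0 hg0 hgz R n
  have h2 : ∀ n ∈ Finset.Icc c R, S R ≤ S n * g ((n : ℝ) / (R : ℝ)) := by
    intro n hn
    rw [Finset.mem_Icc] at hn
    have hn1 : (1 - δ) * R ≤ (n : ℝ) := Nat.ceil_le.mp hn.1
    have hnR : (n : ℝ) ≤ R := Nat.cast_le.mpr hn.2
    have hnpos : 1 ≤ n := by
      have : (0 : ℝ) < n := lt_of_lt_of_le (mul_pos (by linarith) hRpos) hn1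
      exact Nat.cast_pos.mp this
    rw [hg1 _ ⟨by rwa [le_div_iff₀ hRpos], by rwa [div_le_one hRpos]⟩, mul_one]
    exact monoTaub_antitone hstep hnpos hn.2
  have h3 : ((Finset.Icc c R).card : ℝ) * S R ≤ ∑ n ∈ Finset.Icc c R, S n * g ((n : ℝ) / (R : ℝ)) := by
    have := Finset.card_nsmul_le_sum _ _ _ h2
    rwa [nsmul_eq_mul] at this
  have hcard : δ * R ≤ ((Finset.Icc c R).card : ℝ) := by
    rw [Nat.card_Icc, Nat.cast_sub (by omega : c ≤ R + 1)]
    have : (c : ℝ) < (1 - δ) * R + 1 := Nat.ceil_lt_add_one hx0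
    push_cast
    linarith
  have hSR : 0 ≤ S R := hS0 R hR
  calc δ * (S R * (R : ℝ) ^ (1 + α)) = (R : ℝ) ^ α * (δ * R * S R) := by
        rw [add_comm, Real.rpow_add_one hRpos.ne']
        ring
    _ ≤ (R : ℝ) ^ α * (((Finset.Icc c R).card : ℝ) * S R) :=
        mul_le_mul_of_nonneg_left (mul_le_mul_of_nonneg_right hcard hSR) (by positivity)
    _ ≤ (R : ℝ) ^ α * ∑ n ∈ Finset.Icc c R, S n * g ((n : ℝ) / (R : ℝ)) :=
        mul_le_mul_of_nonneg_left h3 (by positivity)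
    _ ≤ (R : ℝ) ^ α * ∑ n ∈ Finset.range (2 * R), S n * g ((n : ℝ) / (R : ℝ)) :=
        mul_le_mul_of_nonneg_left h1 (by positivity)

/-- Upper sandwich: for `g ≤ 1` vanishing off `(1, 1+δ)` and `R ≥ 1`,
`R^α Σ_{n<2R} S(n) g(n/R) ≤ S(R) R^{1+α} (δ + 1/R)` (monotonicity on `R ≤ n ≤ (1+δ)R`). -/
theorem monoTaub_sum_upper {S : ℕ → ℝ} (hS0 : ∀ n : ℕ, 1 ≤ n → 0 ≤ S n)
    (hstep : ∀ n : ℕ, 1 ≤ n → S (n + 1) ≤ S n) {g : ℝ → ℝ} (hg1 : ∀ x, g x ≤ 1)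
    {δ : ℝ} (hδ : 0 < δ) (hδ1 : δ ≤ 1 / 2) (hgz : ∀ x, x ∉ Set.Ioo 1 (1 + δ) → g x = 0) (α : ℝ)
    {R : ℕ} (hR : 1 ≤ R) :
    (R : ℝ) ^ α * ∑ n ∈ Finset.range (2 * R), S n * g ((n : ℝ) / (R : ℝ)) ≤
      S R * (R : ℝ) ^ (1 + α) * (δ + 1 / R) := by
  have hRpos : (0 : ℝ) < R := Nat.cast_pos.mpr hR
  set d : ℕ := ⌊(1 + δ) * (R : ℝ)⌋₊ with hd
  have hd1 : (d : ℝ) ≤ (1 + δ) * R := Nat.floor_le (mul_nonneg (by linarith) hRpos.le)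
  have hRd : R ≤ d := Nat.le_floor (le_mul_of_one_le_left hRpos.le (by linarith))
  have hsub : Finset.Icc R d ⊆ Finset.range (2 * R) := fun n hn => by
    rw [Finset.mem_Icc] at hn
    rw [Finset.mem_range]
    have : (n : ℝ) < 2 * R :=
      calc (n : ℝ) ≤ d := Nat.cast_le.mpr hn.2
        _ ≤ (1 + δ) * R := hd1
        _ < 2 * R := by nlinarith
    exact_mod_cast this
  have heq : ∑ n ∈ Finset.range (2 * R), S n * g ((n : ℝ) / (R : ℝ)) =
      ∑ n ∈ Finset.Icc R d, S n * g ((n : ℝ) / (R : ℝ)) := by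
    refine (Finset.sum_subset hsub fun n _ hn => ?_).symm
    rw [Finset.mem_Icc, not_and_or, not_le, not_le] at hn
    rw [hgz _ ?_, mul_zero]
    rintro ⟨h1, h2⟩
    rcases hn with hn | hn
    · have : (n : ℝ) / R < 1 := by
        rw [div_lt_one hRpos]
        exact_mod_cast hn
      linarith
    · have h3 : (1 + δ) * R < n :=
        calc (1 + δ) * R < d + 1 := Nat.lt_floor_add_one _
          _ ≤ n := by exact_mod_cast Nat.succ_le_of_lt hn
      rw [div_lt_iff₀ hRpos] at h2
      linarith
  have h2 : ∀ n ∈ Finset.Icc R d, S n * g ((n : ℝ) / (R : ℝ)) ≤ S R := by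
    intro n hn
    rw [Finset.mem_Icc] at hn
    calc S n * g ((n : ℝ) / (R : ℝ)) ≤ S n := mul_le_of_le_one_right (hS0 n (hR.trans hn.1)) (hg1 _)
      _ ≤ S R := monoTaub_antitone hstep hR hn.1
  have h3 : ∑ n ∈ Finset.Icc R d, S n * g ((n : ℝ) / (R : ℝ)) ≤ ((Finset.Icc R d).card : ℝ) * S R := by
    have := Finset.sum_le_card_nsmul _ _ _ h2
    rwa [nsmul_eq_mul] at this
  have hcard : ((Finset.Icc R d).card : ℝ) ≤ δ * R + 1 := by
    rw [Nat.card_Icc, Nat.cast_sub (by omega : R ≤ d + 1)]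
    push_cast
    linarith
  have hSR : 0 ≤ S R := hS0 R hR
  calc (R : ℝ) ^ α * ∑ n ∈ Finset.range (2 * R), S n * g ((n : ℝ) / (R : ℝ))
      ≤ (R : ℝ) ^ α * (((Finset.Icc R d).card : ℝ) * S R) := by
        rw [heq]
        exact mul_le_mul_of_nonneg_left h3 (by positivity)
    _ ≤ (R : ℝ) ^ α * ((δ * R + 1) * S R) :=
        mul_le_mul_of_nonneg_left (mul_le_mul_of_nonneg_right hcard hSR) (by positivity)
    _ = S R * (R : ℝ) ^ (1 + α) * (δ + 1 / R) := by
        rw [add_comm (1 : ℝ) α, Real.rpow_add_one hRpos.ne']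
        field_simp

/-- The limit constant `F` is `≥ 0`: test the hypothesis with a nonnegative trapezoid. -/
theorem monoTaub_F_nonneg {S : ℕ → ℝ} {α F : ℝ} (hα : 0 < α) (hS0 : ∀ n : ℕ, 1 ≤ n → 0 ≤ S n)
    (hlim : ∀ g : ℝ → ℝ, Continuous g → HasCompactSupport g → tsupport g ⊆ Set.Ioi 0 →
      Filter.Tendsto (fun R : ℕ => (R : ℝ) ^ α * ∑' n : ℕ, S n * g ((n : ℝ) / (R : ℝ)))
        Filter.atTop (nhds (F * ∫ s in Set.Ioi (0 : ℝ), g s * s ^ (-(1 + α))))) : 0 ≤ F := by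
  obtain ⟨g, hgc, hgs, hgt, hg0, hg1, hgab, hgz⟩ :=
    monoTaub_trapezoid (a' := 1) (a := 5 / 4) (b := 3 / 2) (b' := 2) one_pos (by norm_num)
      (by norm_num) (by norm_num)
  obtain ⟨hIlo, -⟩ := monoTaub_integral_bounds hα one_pos (by norm_num) (by norm_num) (by norm_num)
    hgc hg0 hg1 hgab hgz
  have hIpos : 0 < ∫ s in Set.Ioi (0 : ℝ), g s * s ^ (-(1 + α)) :=
    lt_of_lt_of_le (by positivity) hIlo
  have hg00 : g 0 = 0 := hgz 0 fun h => by linarith [h.1]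
  have hnonneg : ∀ R : ℕ, 0 ≤ (R : ℝ) ^ α * ∑' n : ℕ, S n * g ((n : ℝ) / (R : ℝ)) := fun R => by
    rw [monoTaub_tsum_eq_sum S one_pos le_rfl hgz R]
    exact mul_nonneg (by positivity)
      (Finset.sum_nonneg fun n _ => monoTaub_term_nonneg hS0 hg0 hg00 R n)
  have h := ge_of_tendsto' (hlim g hgc hgs hgt) hnonneg
  by_contra hF
  push Not at hF
  have : F * ∫ s in Set.Ioi (0 : ℝ), g s * s ^ (-(1 + α)) < 0 := mul_neg_of_neg_of_pos hF hIpos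
  linarith

/-- Upper bound: for `0 < δ ≤ 1/2`, eventually `S(R) R^{1+α} ≤ F (1+2δ)(1-δ-δ²)^{-(1+α)} + δ²`. -/
theorem monoTaub_eventually_le {S : ℕ → ℝ} {α F : ℝ} (hα : 0 < α)
    (hS0 : ∀ n : ℕ, 1 ≤ n → 0 ≤ S n) (hstep : ∀ n : ℕ, 1 ≤ n → S (n + 1) ≤ S n)
    (hlim : ∀ g : ℝ → ℝ, Continuous g → HasCompactSupport g → tsupport g ⊆ Set.Ioi 0 →
      Filter.Tendsto (fun R : ℕ => (R : ℝ) ^ α * ∑' n : ℕ, S n * g ((n : ℝ) / (R : ℝ)))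
        Filter.atTop (nhds (F * ∫ s in Set.Ioi (0 : ℝ), g s * s ^ (-(1 + α)))))
    {δ : ℝ} (hδ : 0 < δ) (hδ1 : δ ≤ 1 / 2) :
    ∀ᶠ R : ℕ in Filter.atTop,
      S R * (R : ℝ) ^ (1 + α) ≤ F * ((1 + 2 * δ) * (1 - δ - δ ^ 2) ^ (-(1 + α))) + δ ^ 2 := by
  have hF := monoTaub_F_nonneg hα hS0 hlim
  have ha' : 0 < 1 - δ - δ ^ 2 := by nlinarith
  obtain ⟨g, hgc, hgs, hgt, hg0, hg1, hgab, hgz⟩ :=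
    monoTaub_trapezoid (a' := 1 - δ - δ ^ 2) (a := 1 - δ) (b := 1) (b' := 1 + δ ^ 2) ha'
      (by nlinarith) (by linarith) (by nlinarith)
  obtain ⟨-, hIhi⟩ := monoTaub_integral_bounds hα ha' (by nlinarith) (by linarith) (by nlinarith)
    hgc hg0 hg1 hgab hgz
  have hev : ∀ᶠ R : ℕ in Filter.atTop, (R : ℝ) ^ α * ∑' n : ℕ, S n * g ((n : ℝ) / (R : ℝ)) <
      F * (∫ s in Set.Ioi (0 : ℝ), g s * s ^ (-(1 + α))) + δ ^ 3 :=
    (tendsto_order.1 (hlim g hgc hgs hgt)).2 _ (by linarith [pow_pos hδ 3])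
  have hg00 : g 0 = 0 := hgz 0 fun h => by linarith [h.1]
  filter_upwards [hev, Filter.eventually_ge_atTop 1] with R hR hR1
  rw [monoTaub_tsum_eq_sum S ha' (by nlinarith) hgz R] at hR
  have hlow := monoTaub_sum_lower hS0 hstep hg0 hg00 hδ hδ1 hgab α hR1
  have hFI : F * (∫ s in Set.Ioi (0 : ℝ), g s * s ^ (-(1 + α))) ≤
      F * ((δ + 2 * δ ^ 2) * (1 - δ - δ ^ 2) ^ (-(1 + α))) :=
    mul_le_mul_of_nonneg_left (hIhi.trans (le_of_eq (by ring))) hF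
  refine le_of_mul_le_mul_left ?_ hδ
  calc δ * (S R * (R : ℝ) ^ (1 + α))
      ≤ F * (∫ s in Set.Ioi (0 : ℝ), g s * s ^ (-(1 + α))) + δ ^ 3 := hlow.trans hR.le
    _ ≤ F * ((δ + 2 * δ ^ 2) * (1 - δ - δ ^ 2) ^ (-(1 + α))) + δ ^ 3 := by linarith
    _ = δ * (F * ((1 + 2 * δ) * (1 - δ - δ ^ 2) ^ (-(1 + α))) + δ ^ 2) := by ring

/-- Lower bound: for `0 < δ ≤ 1/2`, eventually `(F (1-2δ)(1+δ)^{-(1+α)} - δ²)/(1+δ) ≤ S(R) R^{1+α}`. -/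
theorem monoTaub_eventually_ge {S : ℕ → ℝ} {α F : ℝ} (hα : 0 < α)
    (hS0 : ∀ n : ℕ, 1 ≤ n → 0 ≤ S n) (hstep : ∀ n : ℕ, 1 ≤ n → S (n + 1) ≤ S n)
    (hlim : ∀ g : ℝ → ℝ, Continuous g → HasCompactSupport g → tsupport g ⊆ Set.Ioi 0 →
      Filter.Tendsto (fun R : ℕ => (R : ℝ) ^ α * ∑' n : ℕ, S n * g ((n : ℝ) / (R : ℝ)))
        Filter.atTop (nhds (F * ∫ s in Set.Ioi (0 : ℝ), g s * s ^ (-(1 + α)))))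
    {δ : ℝ} (hδ : 0 < δ) (hδ1 : δ ≤ 1 / 2) :
    ∀ᶠ R : ℕ in Filter.atTop,
      (F * ((1 - 2 * δ) * (1 + δ) ^ (-(1 + α))) - δ ^ 2) / (1 + δ) ≤ S R * (R : ℝ) ^ (1 + α) := by
  have hF := monoTaub_F_nonneg hα hS0 hlim
  obtain ⟨g, hgc, hgs, hgt, hg0, hg1, hgab, hgz⟩ :=
    monoTaub_trapezoid (a' := 1) (a := 1 + δ ^ 2) (b := 1 + δ - δ ^ 2) (b' := 1 + δ) one_pos
      (by nlinarith) (by nlinarith) (by nlinarith)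
  obtain ⟨hIlo, -⟩ := monoTaub_integral_bounds hα one_pos (by nlinarith) (by nlinarith)
    (by nlinarith) hgc hg0 hg1 hgab hgz
  have hev : ∀ᶠ R : ℕ in Filter.atTop, F * (∫ s in Set.Ioi (0 : ℝ), g s * s ^ (-(1 + α))) - δ ^ 3 <
      (R : ℝ) ^ α * ∑' n : ℕ, S n * g ((n : ℝ) / (R : ℝ)) :=
    (tendsto_order.1 (hlim g hgc hgs hgt)).1 _ (by linarith [pow_pos hδ 3])
  have hevR : ∀ᶠ R : ℕ in Filter.atTop, 1 / δ ^ 2 ≤ (R : ℝ) :=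
    tendsto_natCast_atTop_atTop.eventually_ge_atTop _
  filter_upwards [hev, hevR, Filter.eventually_ge_atTop 1] with R hR hRδ hR1
  have hRpos : (0 : ℝ) < R := Nat.cast_pos.mpr hR1
  rw [monoTaub_tsum_eq_sum S one_pos (by linarith) hgz R] at hR
  have hup := monoTaub_sum_upper hS0 hstep hg1 hδ hδ1 hgz α hR1
  have hT0 : 0 ≤ S R * (R : ℝ) ^ (1 + α) := mul_nonneg (hS0 R hR1) (by positivity)
  have h1R : 1 / (R : ℝ) ≤ δ ^ 2 := by
    rw [div_le_iff₀ hRpos]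
    rw [div_le_iff₀ (pow_pos hδ 2)] at hRδ
    linarith
  have hFI : F * ((δ - 2 * δ ^ 2) * (1 + δ) ^ (-(1 + α))) ≤
      F * (∫ s in Set.Ioi (0 : ℝ), g s * s ^ (-(1 + α))) :=
    mul_le_mul_of_nonneg_left ((le_of_eq (by ring)).trans hIlo) hF
  rw [div_le_iff₀ (by linarith : (0 : ℝ) < 1 + δ)]
  refine le_of_mul_le_mul_left ?_ hδ
  calc δ * (F * ((1 - 2 * δ) * (1 + δ) ^ (-(1 + α))) - δ ^ 2)
      = F * ((δ - 2 * δ ^ 2) * (1 + δ) ^ (-(1 + α))) - δ ^ 3 := by ring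
    _ ≤ F * (∫ s in Set.Ioi (0 : ℝ), g s * s ^ (-(1 + α))) - δ ^ 3 := by linarith
    _ ≤ (R : ℝ) ^ α * ∑ n ∈ Finset.range (2 * R), S n * g ((n : ℝ) / (R : ℝ)) := hR.le
    _ ≤ S R * (R : ℝ) ^ (1 + α) * (δ + 1 / R) := hup
    _ ≤ S R * (R : ℝ) ^ (1 + α) * (δ + δ ^ 2) := mul_le_mul_of_nonneg_left (by linarith) hT0
    _ = δ * (S R * (R : ℝ) ^ (1 + α) * (1 + δ)) := by ring

/-- The upper constant `δ ↦ F (1+2δ)(1-δ-δ²)^{-(1+α)} + δ²` tends to `F` as `δ → 0⁺`. -/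
theorem monoTaub_tendsto_upper (α F : ℝ) :
    Filter.Tendsto (fun δ : ℝ => F * ((1 + 2 * δ) * (1 - δ - δ ^ 2) ^ (-(1 + α))) + δ ^ 2)
      (nhdsWithin 0 (Set.Ioi 0)) (nhds F) := by
  apply tendsto_nhdsWithin_of_tendsto_nhds
  have h1 : Filter.Tendsto (fun δ : ℝ => 1 - δ - δ ^ 2) (nhds 0) (nhds 1) := by
    have : Continuous (fun δ : ℝ => 1 - δ - δ ^ 2) := by fun_prop
    simpa using this.tendsto 0
  have h2 : Filter.Tendsto (fun δ : ℝ => (1 - δ - δ ^ 2) ^ (-(1 + α))) (nhds 0) (nhds 1) := by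
    simpa using h1.rpow_const (Or.inl one_ne_zero)
  have h3 : Filter.Tendsto (fun δ : ℝ => 1 + 2 * δ) (nhds 0) (nhds 1) := by
    have : Continuous (fun δ : ℝ => 1 + 2 * δ) := by fun_prop
    simpa using this.tendsto 0
  have h4 : Filter.Tendsto (fun δ : ℝ => δ ^ 2) (nhds 0) (nhds 0) := by
    have : Continuous (fun δ : ℝ => δ ^ 2) := by fun_prop
    simpa using this.tendsto 0
  have h := ((h3.mul h2).const_mul F).add h4
  simp only [mul_one, add_zero] at h
  exact h

/-- The lower constant `δ ↦ (F (1-2δ)(1+δ)^{-(1+α)} - δ²)/(1+δ)` tends to `F` as `δ → 0⁺`. -/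
theorem monoTaub_tendsto_lower (α F : ℝ) :
    Filter.Tendsto (fun δ : ℝ => (F * ((1 - 2 * δ) * (1 + δ) ^ (-(1 + α))) - δ ^ 2) / (1 + δ))
      (nhdsWithin 0 (Set.Ioi 0)) (nhds F) := by
  apply tendsto_nhdsWithin_of_tendsto_nhds
  have h1 : Filter.Tendsto (fun δ : ℝ => 1 + δ) (nhds 0) (nhds 1) := by
    have : Continuous (fun δ : ℝ => 1 + δ) := by fun_prop
    simpa using this.tendsto 0
  have h2 : Filter.Tendsto (fun δ : ℝ => (1 + δ) ^ (-(1 + α))) (nhds 0) (nhds 1) := by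
    simpa using h1.rpow_const (Or.inl one_ne_zero)
  have h3 : Filter.Tendsto (fun δ : ℝ => 1 - 2 * δ) (nhds 0) (nhds 1) := by
    have : Continuous (fun δ : ℝ => 1 - 2 * δ) := by fun_prop
    simpa using this.tendsto 0
  have h4 : Filter.Tendsto (fun δ : ℝ => δ ^ 2) (nhds 0) (nhds 0) := by
    have : Continuous (fun δ : ℝ => δ ^ 2) := by fun_prop
    simpa using this.tendsto 0
  have h := (((h3.mul h2).const_mul F).sub h4).div h1 one_ne_zero
  simp only [mul_one, sub_zero, div_one] at h
  exact h

/-- **Monotone Tauberian step on `ℕ`** (stub `stub_monotoneTauberian` of line `self-energy-pick-inversion`):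
a sequence `S` that is `≥ 0` and non-increasing from `n = 1` on, and whose rescaled counting functionals
`R^α Σ_n S(n) g(n/R)` converge to `F ∫₀^∞ g(s) s^{-1-α} ds` for every continuous `g` compactly supported in
`(0,∞)`, satisfies `S(n)·n^{1+α} → F`.  Sandwich by monotonicity against trapezoidal test functions and
`δ → 0⁺`. [folklore; Bingham–Goldie–Teugels 1987 §1.7, monotone density theorem] -/
theorem stub_monotoneTauberian :
    ∀ (S : ℕ → ℝ) (α F : ℝ), 0 < α → (∀ n : ℕ, 1 ≤ n → 0 ≤ S n) →
    (∀ n : ℕ, 1 ≤ n → S (n + 1) ≤ S n) →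
    (∀ g : ℝ → ℝ, Continuous g → HasCompactSupport g → tsupport g ⊆ Set.Ioi 0 →
      Filter.Tendsto (fun R : ℕ => (R : ℝ) ^ α * ∑' n : ℕ, S n * g ((n : ℝ) / (R : ℝ)))
        Filter.atTop (nhds (F * ∫ s in Set.Ioi (0 : ℝ), g s * s ^ (-(1 + α))))) →
    Filter.Tendsto (fun n : ℕ => S n * (n : ℝ) ^ (1 + α)) Filter.atTop (nhds F) := by
  intro S α F hα hS0 hstep hlim
  have hmem : ∀ᶠ δ in nhdsWithin (0 : ℝ) (Set.Ioi 0), δ ∈ Set.Ioc (0 : ℝ) (1 / 2) :=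
    Ioc_mem_nhdsGT (by norm_num)
  rw [tendsto_order]
  refine ⟨fun a ha => ?_, fun a ha => ?_⟩
  · obtain ⟨δ, hδa, hδ0, hδ1⟩ :=
      (((tendsto_order.1 (monoTaub_tendsto_lower α F)).1 a ha).and hmem).exists
    exact (monoTaub_eventually_ge hα hS0 hstep hlim hδ0 hδ1).mono fun R hR => hδa.trans_le hR
  · obtain ⟨δ, hδa, hδ0, hδ1⟩ :=
      (((tendsto_order.1 (monoTaub_tendsto_upper α F)).2 a ha).and hmem).exists
    exact (monoTaub_eventually_le hα hS0 hstep hlim hδ0 hδ1).mono fun R hR => hR.trans_lt hδa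

end Summit.CriticalPhenomena.Ising3DConformalLimit.Cruxes.DirectCorrelationStableTail.SelfEnergyPickInversion
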